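import Literature.NumberTheory.EllipticCurves.HeegnerPointsKolyvaginConjugation
import Literature.NumberTheory.EllipticCurves.WeilPairingProofs
import Literature.NumberTheory.EllipticCurves.BSDSelmerPConverseSerreProofs
import Literature.NumberTheory.EllipticCurves.SelmerTorsionInclusion
import HarnessLib

/-!
# Crux V2♭ `KolyvaginCorankLowerBoundAtTwo` (stmt-BirchSwinnertonDyer-24623), line `kolyvagin_depth_split`,
# stub T5⁺ (window supply), input T5b(a′): ČEBOTAREV AT `2` FOR ONE EIGENCLASS — the algebra
# (helper, PROVED; width seat `bsd-line-krr2-p2` g6)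

The window step T5b of the lead's skeleton needs, for ONE Kolyvagin class `κ = c_M(n)` with
`τκ = εκ` (`ε = ±1`, stub T3) and large order, a NEW Kolyvagin prime `q` at `2` at whose place
`κ` has large LOCAL order ("Čebotarev with prescribed local order", Kolyvagin [LNM 1479, Prop. 8];
McCallum 1991 Cor. 3.2 / Gross 1991 §9 at odd `p`). The tree proves the odd-`p` statement and, at
`p = 2` on `Δ_E < 0`, the version for `τ`-STABLE INDEPENDENT families meeting the inflation kernel
trivially (`GenusExact.equivariantChebotarevAtTwo_of_not_isSquare`, seat gk2-p2) — whose Step B uses a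
free generator of `E[2^M]` over `ℤ/2^M[τ]`, which exists iff `Δ_E < 0`. This file supplies the three
algebraic inputs of a ONE-CLASS version valid for BOTH signs of `Δ_E` and both eigen-signs, losing
at most two bits and assuming no injectivity of restriction:

* `exists_pow_smul_add_sign_conj_ne_zero` — **`(1 + ε c₀) E[2^m] ⊄ E[2^m][2^{m-2}]`** (`m ≥ 2`,
  `ε = ±1`, `c₀` a complex conjugation): by the tree's PROVED Weil pairing
  (`exists_weilPairing_holds`) and `c₀ ζ = ζ⁻¹` (`RatClosure.smul_eq_inv_of_pow_eq_one`), a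
  congruence `c₀ ≡ -ε (mod E[2^{m-2}]·)` would force `ζ² ∈ μ_{2^{m-2}}` for a pairing value `ζ` of
  order `≥ 2^{m-1}`. ONE bit is lost (and is lost for `Δ_E > 0`, where `τ = diag(1,-1)`); no
  eigenbasis and no sign hypothesis on `Δ_E` is used.
* `two_zsmul_eq_zero_of_h1Eval_eq_zero` — **Sah / Gross Prop. 9.1 at `2`**: if some `z ∈ Γ_K` acts
  as `-1` on `E[n]`, a class of `H¹(K, E[n])` vanishing on `Γ_{K(E[n])}` is killed by `2` (the
  tree's `eq_zero_of_h1Eval_eq_zero` needs `2 ∈ (ℤ/n)^×`); `exists_smul_eq_neg_two_pow` — such a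
  `z` exists when `ρ̄_{E,2^M}` is onto over `ℚ` and `[K:ℚ] = 2` (`-1` is the square of a quarter
  turn; `RatClosure.exists_smul_eq_of_sq`). The second lost bit.
* `torsionBy_le_of_stable_of_pow_smul_ne_zero` — **dévissage**: a `Γ_K`-stable subgroup of
  `E[2^M]` with an element of order `> 2^j` contains `E[2^M][2^{j+1}]`, from the simplicity of
  `E[2]` alone (one-class case of McCallum's (2) / Gross Prop. 9.3).

The sequel `Theorems/KolyvaginRankRigidityAtTwoChebotarevOneClassAtTwo.lean` feeds these into the
tree's `p`-generic Steps C–G (`exists_kolyvaginPrime_gt_of_galoisElement`). HONEST FRAMING: helper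
lemmas (`--supports` 24623); neither T5⁺ nor V2♭ is proved here; BSD is not proved by any of this.

References: [SilvermanAEC2009] III.8.1; [GrossLMS1991] §9 Prop. 9.1, 9.3; [McCallumLMS1991] §3 (2),
Prop. 3.1, Cor. 3.2; [Sah1968] Prop. 2.7 (b); [Kolyvagin1991MathAnn] §2 (reference [1], Prop. 8).
-/

set_option autoImplicit false
-- the Theorems namespace of this sub repeats the summit name by design (D-0017 nested layout)
set_option linter.dupNamespace false

noncomputable section

open scoped Classical

namespace Summit.BirchSwinnertonDyer.BirchSwinnertonDyer.Theorems.KolyvaginLowerBoundAtTwo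

open WeierstrassCurve Field
open Literature.NumberTheory.GaloisRepresentations Literature.NumberTheory.EllipticCurves

universe u

/-! ### One bit: complex conjugation is not `∓1` modulo `E[2^{m-2}]` -/

/-- **Complex conjugation is never `∓1` modulo `4` on `E[2^m]`** (`m ≥ 2`): for `ε = ±1` some
`x ∈ E(ℚ̄)[2^m]` has `2^{m-2} (x + ε c₀ x) ≠ 0`, i.e. `(1 + ε c₀) E[2^m] ⊄ E[2^m][2^{m-2}]`.
Proof by the Weil pairing: `c₀ ζ = ζ⁻¹` on `μ_{2^m}` while `c₀ ≡ -ε (mod E[2^{m-2}]·)` would give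
`c₀ ζ ≡ ζ` modulo `μ_{2^{m-2}}` for the value `ζ = e(S, T)` of exact order `≥ 2^{m-1}`.
(At odd `p` this is the existence of both eigenvalues, the tree's `RatClosure.exists_eigenvectors`;
at `2` it is the uniform one-bit substitute, valid for both signs of `Δ_E`.)
[cite: SilvermanAEC2009, Prop. III.8.1] [cite: McCallumLMS1991, §3 (before Prop. 3.1)] -/
theorem exists_pow_smul_add_sign_conj_ne_zero (W : WeierstrassCurve ℚ) [W.IsElliptic]
    {c₀ : absoluteGaloisGroup ℚ} (hc₀ : IsComplexConjugation (Rat.castHom ℝ) c₀)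
    {m : ℕ} (hm : 2 ≤ m) {ε : ℤ} (hε : ε = 1 ∨ ε = -1) :
    ∃ x : geomTorsion W ((2 ^ m : ℕ) : ℤ), (2 ^ (m - 2)) • (x + ε • c₀ • x) ≠ 0 := by
  by_contra! hall
  -- the Weil pairing on `E[2^m]`
  have h2m : 2 ≤ 2 ^ m := by
    calc 2 = 2 ^ 1 := by norm_num
      _ ≤ 2 ^ m := Nat.pow_le_pow_right (by norm_num) (by omega)
  have hq0 : ((2 ^ m : ℕ) : ℚ) ≠ 0 := by positivity
  obtain ⟨w, hpow, haddl, haddr, halt, hnd, hgal⟩ := W.exists_weilPairing_holds (2 ^ m) h2m hq0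
  have hne : ∀ S T, w S T ≠ 0 := fun S T h0 ↦ by
    have := hpow S T
    rw [h0, zero_pow (by positivity)] at this
    exact zero_ne_one this
  have hzero_left : ∀ T, w 0 T = 1 := fun T ↦ by
    have h := haddl 0 0 T
    rw [add_zero] at h
    exact (mul_eq_left₀ (hne 0 T)).mp h.symm
  have hzero_right : ∀ S, w S 0 = 1 := fun S ↦ by
    have h := haddr S 0 0
    rw [add_zero] at h
    exact (mul_eq_left₀ (hne S 0)).mp h.symm
  have hnsmul_left : ∀ (a : ℕ) S T, w (a • S) T = w S T ^ a := fun a S T ↦ by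
    induction a with
    | zero => rw [zero_nsmul, pow_zero, hzero_left]
    | succ a ih => rw [succ_nsmul, haddl, ih, pow_succ]
  have hnsmul_right : ∀ (a : ℕ) S T, w S (a • T) = w S T ^ a := fun a S T ↦ by
    induction a with
    | zero => rw [zero_nsmul, pow_zero, hzero_right]
    | succ a ih => rw [succ_nsmul, haddr, ih, pow_succ]
  have hneg_left : ∀ S T, w (-S) T = (w S T)⁻¹ := fun S T ↦ by
    have h := haddl (-S) S T
    rw [neg_add_cancel, hzero_left] at h
    exact (eq_inv_of_mul_eq_one_left h.symm)
  have hneg_right : ∀ S T, w S (-T) = (w S T)⁻¹ := fun S T ↦ by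
    have h := haddr S (-T) T
    rw [neg_add_cancel, hzero_right] at h
    exact (eq_inv_of_mul_eq_one_left h.symm)
  have hsub_left : ∀ S S' T, w (S - S') T = w S T * (w S' T)⁻¹ := fun S S' T ↦ by
    rw [sub_eq_add_neg, haddl, hneg_left]
  have hsub_right : ∀ S T T', w S (T - T') = w S T * (w S T')⁻¹ := fun S T T' ↦ by
    rw [sub_eq_add_neg, haddr, hneg_right]
  -- the sign does not change the pairing of two conjugated points
  have hsign : ∀ S T, w (ε • c₀ • S) (ε • c₀ • T) = w (c₀ • S) (c₀ • T) := fun S T ↦ by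
    rcases hε with rfl | rfl
    · rw [one_zsmul, one_zsmul]
    · rw [neg_one_zsmul, neg_one_zsmul, hneg_left, hneg_right, inv_inv]
  -- a point `S₀` of exact order `2^m` (frame `E[2^m] ≃ (ℤ/2^m)²`)
  obtain ⟨e⟩ := nonempty_addEquiv_geomTorsion W 2 m (by omega) (by norm_num)
  set S₀ : geomTorsion W ((2 ^ m : ℕ) : ℤ) := e.symm (Pi.single 0 1) with hS₀
  have hS₀ne : (2 ^ (m - 1)) • S₀ ≠ 0 := by
    intro h0
    have h1 : e ((2 ^ (m - 1)) • S₀) 0 = 0 := by rw [h0, map_zero, Pi.zero_apply]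
    rw [map_nsmul, hS₀, e.apply_symm_apply, Pi.smul_apply, Pi.single_eq_same, nsmul_eq_mul,
      mul_one] at h1
    have h2 : ((2 ^ (m - 1) : ℕ) : ZMod (2 ^ m)) = 0 := by exact_mod_cast h1
    rw [ZMod.natCast_eq_zero_iff] at h2
    have h3 : 2 ^ m ≤ 2 ^ (m - 1) := Nat.le_of_dvd (by positivity) h2
    have h4 : 2 ^ (m - 1) < 2 ^ m := Nat.pow_lt_pow_right (by norm_num) (by omega)
    omega
  -- a partner `S'` with `ζ = e(S', S₀)` of order `≥ 2^{m-1}`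
  obtain ⟨S', hS'⟩ : ∃ S', w S' ((2 ^ (m - 1)) • S₀) ≠ 1 := by
    by_contra! h
    exact hS₀ne (hnd _ h)
  have hζ : w S' S₀ ^ (2 ^ (m - 1)) ≠ 1 := by rwa [← hnsmul_right]
  -- complex conjugation inverts `ζ`
  have hinv : c₀ • w S' S₀ = (w S' S₀)⁻¹ :=
    RatClosure.smul_eq_inv_of_pow_eq_one hc₀ (by positivity) (hpow S' S₀)
  -- and, under `hall`, multiplies it by a `2^{m-2}`-th root of unity
  set u := S' + ε • c₀ • S' with hu
  set v := S₀ + ε • c₀ • S₀ with hv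
  have hu0 : (2 ^ (m - 2)) • u = 0 := hall S'
  have hv0 : (2 ^ (m - 2)) • v = 0 := hall S₀
  have hcS' : ε • c₀ • S' = u - S' := by rw [hu, add_sub_cancel_left]
  have hcS₀ : ε • c₀ • S₀ = v - S₀ := by rw [hv, add_sub_cancel_left]
  set η := w u v * (w u S₀)⁻¹ * (w S' v)⁻¹ with hη
  have hconj : c₀ • w S' S₀ = w S' S₀ * η := by
    rw [hη, hgal, ← hsign, hcS', hcS₀, hsub_left, hsub_right, hsub_right, mul_inv, inv_inv]
    ring
  have hroot : η ^ (2 ^ (m - 2)) = 1 := by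
    rw [hη, mul_pow, mul_pow, inv_pow, inv_pow, ← hnsmul_left, ← hnsmul_left, ← hnsmul_right, hu0,
      hv0, hzero_left, hzero_left, hzero_right, inv_one, mul_one, mul_one]
  have hη0 : η ≠ 0 := by
    rw [hη]
    exact mul_ne_zero (mul_ne_zero (hne _ _) (inv_ne_zero (hne _ _))) (inv_ne_zero (hne _ _))
  -- so `ζ² = η⁻¹ ∈ μ_{2^{m-2}}`, i.e. `ζ^{2^{m-1}} = 1`: contradiction
  apply hζ
  have hsq : w S' S₀ ^ 2 = η⁻¹ := by
    have h : (w S' S₀)⁻¹ = w S' S₀ * η := hinv.symm.trans hconj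
    have h1 : w S' S₀ ^ 2 * η = 1 := by
      rw [pow_two, mul_assoc, ← h, mul_inv_cancel₀ (hne S' S₀)]
    exact eq_inv_of_mul_eq_one_left h1
  have hm2 : 2 ^ (m - 1) = 2 * 2 ^ (m - 2) := by
    rw [← pow_succ']
    congr 1
    omega
  rw [hm2, pow_mul, hsq, inv_pow, hroot, inv_one]


/-! ### Sah's lemma at `2`: the inflation kernel is killed by `2` -/

section Sah

variable {K : Type u} [Field K] (V : WeierstrassCurve K) (n : ℤ)

/-- **The kernel of `H¹(K, E[n]) → Hom(Γ_{K(E[n])}, E[n])` is killed by `2` when some `z ∈ Γ_K`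
acts on `E[n]` as `-1`** (Gross 1991 Prop. 9.1 / Serre's argument, at `p = 2`: for a cocycle `f`
of `x` with all `[x, ρ] = 0`, `2 f(g) = f(z) - g f(z)` is a coboundary; at odd `p` the tree's
`eq_zero_of_h1Eval_eq_zero` divides by `2` and gets `x = 0`, at `2` exactly one bit is lost:
`H¹(GL₂(ℤ/2^M), (ℤ/2^M)²) = ℤ/2` for `M ≥ 2`). [cite: GrossLMS1991, Prop. 9.1 (proof)]
[cite: Sah1968, Prop. 2.7 (b)] -/
theorem two_zsmul_eq_zero_of_h1Eval_eq_zero {z : absoluteGaloisGroup K}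
    (hz : ∀ P : geomTorsion V n, z • P = -P) {x : galH1Torsion V n}
    (hx : ∀ ρ ∈ torsionFixing V n, h1Eval V n x ρ = 0) : (2 : ℤ) • x = 0 := by
  rw [← oneCocycleClass_reprCocycle V n x, two_zsmul, ← oneCocycleClass_add]
  set φ := reprCocycle V n x with hφ
  refine (oneCocycleClass_eq_zero_iff _ (φ + φ)).mpr ⟨-(φ.1 z), fun g ↦ ?_⟩
  -- `n₀ = z⁻¹ g⁻¹ z g` acts trivially on `E[n]`
  have hn₀ : z⁻¹ * g⁻¹ * z * g ∈ torsionFixing V n := by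
    refine (mem_torsionFixing_iff V n).mpr fun P ↦ ?_
    have hz' : ∀ Q : geomTorsion V n, z⁻¹ • Q = -Q := fun Q ↦ by
      have := hz (z⁻¹ • Q)
      rw [smul_inv_smul] at this
      rw [← neg_neg (z⁻¹ • Q), ← this]
    rw [mul_smul, mul_smul, mul_smul, hz, smul_neg, hz', neg_neg, inv_smul_smul]
  have hzg : z * g = g * z * (z⁻¹ * g⁻¹ * z * g) := by group
  have h1 := φ.2 z g
  have h2 := φ.2 (g * z) (z⁻¹ * g⁻¹ * z * g)
  have h3 := φ.2 g z
  rw [discreteTopRep_ρ_apply] at h1 h2 h3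
  have h4 : φ.1 (z⁻¹ * g⁻¹ * z * g) = 0 := hx _ hn₀
  rw [← hzg, h1, h4, smul_zero, add_zero, h3, hz] at h2
  -- `h2 : φ z + -φ g = φ g + g • φ z`
  have key : φ.1 g + φ.1 g = φ.1 z - g • φ.1 z := by
    rw [← sub_eq_zero] at h2 ⊢
    have e : φ.1 g + φ.1 g - (φ.1 z - g • φ.1 z) = -(φ.1 z + -φ.1 g - (φ.1 g + g • φ.1 z)) := by
      abel
    rw [e, h2, neg_zero]
  change (φ.1 + φ.1) g = _
  rw [ContinuousMap.add_apply, key, discreteTopRep_ρ_apply, smul_neg]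
  abel

end Sah

/-! ### An element of `Γ_K` acting as `-1` on `E[2^M]` (the square of a quarter turn) -/

section MinusOne

/-- **Some `z ∈ Γ_K` acts as `-1` on `E(K̄)[2^M]`** when `ρ̄_{E,2^M} : Γ_ℚ → Aut E[2^M]` is onto
and `[K : ℚ] = 2`: `-1` is the square of the quarter turn of a frame `E[2^M] ≃ (ℤ/2^M)²`, and
every square of an automorphism is realised by `Γ_K` (`RatClosure.exists_smul_eq_of_sq`, index
`2`). (The `p`-odd route — `-1 ∈ ρ̄(Γ_K)` from `-1 = (-1)·1²`-type arguments needs nothing; at `2`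
on the Heegner habitat `K ⊄ ℚ(E[2^M])` would also give it, this is the ramification-free road.)
[cite: GrossLMS1991, §9 (before Prop. 9.1)] -/
theorem exists_smul_eq_neg_two_pow (W : WeierstrassCurve ℚ) [W.IsElliptic] {K : Type u}
    [Field K] [NumberField K] (hK : Module.finrank ℚ K = 2) {M : ℕ} (hM : 1 ≤ M)
    (hρ : W.HasSurjectiveModNGaloisRep ((2 ^ M : ℕ) : ℤ)) :
    ∃ z : absoluteGaloisGroup K, ∀ Q : geomTorsion (W.baseChange K) ((2 ^ M : ℕ) : ℤ),
      z • Q = -Q := by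
  haveI : (W.baseChange K).IsElliptic := by rw [baseChange]; infer_instance
  obtain ⟨e⟩ := nonempty_addEquiv_geomTorsion (W.baseChange K) 2 M hM (by norm_num)
  -- the quarter turn `(a, b) ↦ (b, -a)` of `(ℤ/2^M)²`, of square `-1`
  let J : (Fin 2 → ZMod (2 ^ M)) ≃+ (Fin 2 → ZMod (2 ^ M)) :=
    { toFun := fun x ↦ ![x 1, -x 0]
      invFun := fun x ↦ ![-x 1, x 0]
      left_inv := fun x ↦ by ext i; fin_cases i <;> simp
      right_inv := fun x ↦ by ext i; fin_cases i <;> simp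
      map_add' := fun x y ↦ by ext i; fin_cases i <;> simp [add_comm] }
  have hJJ : ∀ x, J (J x) = -x := fun x ↦ by ext i; fin_cases i <;> simp [J]
  obtain ⟨z, hz⟩ := RatClosure.exists_smul_eq_of_sq W hK hρ (e.trans (J.trans e.symm))
  refine ⟨z, fun Q ↦ ?_⟩
  rw [hz Q]
  simp only [AddEquiv.trans_apply, AddEquiv.apply_symm_apply, hJJ, map_neg,
    AddEquiv.symm_apply_apply]

end MinusOne

/-! ### A `Γ_K`-stable subgroup of `E[2^M]` reaching order `2^{j+1}` contains `E[2^M][2^{j+1}]` -/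

section Devissage

variable {K : Type u} [Field K] (V : WeierstrassCurve K)

/-- **Dévissage from the simplicity of `E[2]`.** Let `E(K̄)[2]` be a simple `Γ_K`-module. If a
`Γ_K`-stable subgroup `H ≤ E(K̄)[2^M]` contains an element `h₀` with
`2^j h₀ ≠ 0`, then `H` contains every `t` with `2^{j+1} t = 0`. (Induction on `j`: the bottom
layer `H ∩ E[2]` is non-zero and stable, hence all of `E[2]`; and `2H` is stable with
`2^{j-1}(2h₀) ≠ 0`.) This is the one-class case of McCallum's (2) / Gross's Prop. 9.3 ("the image
of `[s, ·]` is all of `E_p`") at a prime power, at `p = 2`. [cite: GrossLMS1991, Prop. 9.3]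
[cite: McCallumLMS1991, §3 (2)] -/
theorem torsionBy_le_of_stable_of_pow_smul_ne_zero (M : ℕ)
    (hS : ∀ H : AddSubgroup (geomTorsion V 2),
      (∀ g : absoluteGaloisGroup K, ∀ t ∈ H, g • t ∈ H) → H = ⊥ ∨ H = ⊤) :
    ∀ (j : ℕ) (H : AddSubgroup (geomTorsion V ((2 ^ M : ℕ) : ℤ))),
      (∀ g : absoluteGaloisGroup K, ∀ t ∈ H, g • t ∈ H) →
      (∃ h₀ ∈ H, (2 : ℤ) ^ j • h₀ ≠ 0) →
      ∀ t : geomTorsion V ((2 ^ M : ℕ) : ℤ), (2 : ℤ) ^ (j + 1) • t = 0 → t ∈ H := by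
  rcases Nat.eq_zero_or_pos M with hM0 | hMpos
  · -- `E[1] = 0`: nothing to prove
    subst hM0
    intro j H _ ⟨h₀, _, hne⟩
    exfalso
    apply hne
    have h1 : ((2 ^ 0 : ℕ) : ℤ) • (h₀ : geomPoints V) = 0 :=
      (mem_geomTorsion_iff V _ (h₀ : geomPoints V)).mp h₀.2
    have h1' : (h₀ : geomPoints V) = 0 := by
      have e : ((2 ^ 0 : ℕ) : ℤ) = 1 := by norm_num
      simpa only [e, one_smul] using h1
    have : h₀ = 0 := Subtype.ext (h1'.trans (ZeroMemClass.coe_zero _).symm)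
    rw [this, smul_zero]
  have h2n : (2 : ℤ) ∣ ((2 ^ M : ℕ) : ℤ) := by
    rw [Nat.cast_pow, Nat.cast_ofNat]
    exact dvd_pow_self 2 (by omega)
  -- the inclusion `E[2] ↪ E[2^M]`
  set ι₁ : geomTorsion V 2 →+ geomTorsion V ((2 ^ M : ℕ) : ℤ) :=
    AddSubgroup.inclusion (V.geomTorsion_le_of_dvd h2n) with hι₁
  have hιG : ∀ (g : absoluteGaloisGroup K) (s : geomTorsion V 2), ι₁ (g • s) = g • ι₁ s :=
    fun _ _ ↦ rfl
  have hrange : ∀ t : geomTorsion V ((2 ^ M : ℕ) : ℤ), (2 : ℤ) • t = 0 → ∃ s, ι₁ s = t :=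
    fun t ht ↦ by
    have ht' : (2 : ℤ) • (t : geomPoints V) = 0 := by
      rw [← AddSubgroupClass.coe_zsmul, ht, ZeroMemClass.coe_zero]
    exact ⟨⟨(t : geomPoints V), (mem_geomTorsion_iff V 2 _).mpr ht'⟩, rfl⟩
  have hkill : ∀ h₀ : geomTorsion V ((2 ^ M : ℕ) : ℤ), (2 : ℤ) ^ M • h₀ = 0 := fun h₀ ↦ by
    apply Subtype.ext
    rw [AddSubgroupClass.coe_zsmul, ZeroMemClass.coe_zero]
    have := (mem_geomTorsion_iff V _ (h₀ : geomPoints V)).mp h₀.2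
    exact_mod_cast this
  -- bottom layer: a stable `H` with a non-zero element contains `E[2^M][2]`
  have hbottom : ∀ (H : AddSubgroup (geomTorsion V ((2 ^ M : ℕ) : ℤ))),
      (∀ g : absoluteGaloisGroup K, ∀ t ∈ H, g • t ∈ H) → (∃ h₀ ∈ H, h₀ ≠ 0) →
      ∀ t : geomTorsion V ((2 ^ M : ℕ) : ℤ), (2 : ℤ) • t = 0 → t ∈ H := by
    classical
    intro H hH ⟨h₀, hh₀, hne⟩ t ht
    -- the last non-zero multiple `2^(s-1) h₀` is `2`-torsion
    have hex : ∃ a : ℕ, (2 : ℤ) ^ a • h₀ = 0 := ⟨M, hkill h₀⟩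
    set s := Nat.find hex with hs
    have hspec : (2 : ℤ) ^ s • h₀ = 0 := Nat.find_spec hex
    have hs0 : s ≠ 0 := fun h ↦ hne (by rw [h, pow_zero, one_smul] at hspec; exact hspec)
    have hmin : (2 : ℤ) ^ (s - 1) • h₀ ≠ 0 := Nat.find_min hex (by omega)
    have hh₁H : (2 : ℤ) ^ (s - 1) • h₀ ∈ H := AddSubgroup.zsmul_mem _ hh₀ _
    have hh₁2 : (2 : ℤ) • ((2 : ℤ) ^ (s - 1) • h₀) = 0 := by
      rw [smul_smul, ← pow_succ', Nat.sub_add_cancel (Nat.one_le_iff_ne_zero.mpr hs0), hspec]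
    -- `H ∩ E[2]`, pulled back to `E[2]`, is stable and non-zero, hence everything
    set H₂ : AddSubgroup (geomTorsion V 2) := H.comap ι₁ with hH₂
    have hH₂stab : ∀ g : absoluteGaloisGroup K, ∀ u ∈ H₂, g • u ∈ H₂ := fun g u hu ↦ by
      rw [hH₂, AddSubgroup.mem_comap] at hu ⊢
      rw [hιG]
      exact hH g _ hu
    obtain ⟨s₁, hs₁⟩ := hrange _ hh₁2
    have hH₂top : H₂ = ⊤ := by
      rcases hS H₂ hH₂stab with h | h
      · exfalso
        apply hmin
        have : s₁ ∈ H₂ := by rw [hH₂, AddSubgroup.mem_comap, hs₁]; exact hh₁H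
        rw [h, AddSubgroup.mem_bot] at this
        rw [← hs₁, this, map_zero]
      · exact h
    obtain ⟨s₂, hs₂⟩ := hrange t ht
    have : s₂ ∈ H₂ := by rw [hH₂top]; trivial
    rw [hH₂, AddSubgroup.mem_comap, hs₂] at this
    exact this
  -- induction on `j`
  intro j
  induction j with
  | zero =>
    intro H hH ⟨h₀, hh₀, hne⟩ t ht
    rw [pow_zero, one_smul] at hne
    exact hbottom H hH ⟨h₀, hh₀, hne⟩ t (by simpa using ht)
  | succ j ih =>
    intro H hH ⟨h₀, hh₀, hne⟩ t ht
    -- `2H` is stable and reaches order `2^j`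
    set H' : AddSubgroup (geomTorsion V ((2 ^ M : ℕ) : ℤ)) :=
      H.map (zsmulAddGroupHom 2 : geomTorsion V ((2 ^ M : ℕ) : ℤ) →+ _) with hH'
    have hH'app : ∀ u : geomTorsion V ((2 ^ M : ℕ) : ℤ),
        (zsmulAddGroupHom 2 : geomTorsion V ((2 ^ M : ℕ) : ℤ) →+ _) u = (2 : ℤ) • u :=
      fun _ ↦ rfl
    have hH'stab : ∀ g : absoluteGaloisGroup K, ∀ u ∈ H', g • u ∈ H' := fun g u hu ↦ by
      rw [hH', AddSubgroup.mem_map] at hu ⊢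
      obtain ⟨u₀, hu₀, rfl⟩ := hu
      refine ⟨g • u₀, hH g u₀ hu₀, ?_⟩
      rw [hH'app, hH'app, smul_comm]
    have h2h₀ : (2 : ℤ) • h₀ ∈ H' := by
      rw [hH', AddSubgroup.mem_map]; exact ⟨h₀, hh₀, rfl⟩
    have hne' : (2 : ℤ) ^ j • ((2 : ℤ) • h₀) ≠ 0 := by
      rwa [smul_smul, ← pow_succ]
    -- `2t ∈ 2H`
    have h2t : (2 : ℤ) • t ∈ H' :=
      ih H' hH'stab ⟨_, h2h₀, hne'⟩ _ (by rw [smul_smul, ← pow_succ]; exact ht)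
    rw [hH', AddSubgroup.mem_map] at h2t
    obtain ⟨h, hh, hht⟩ := h2t
    rw [hH'app] at hht
    -- `t - h ∈ E[2^M][2] ⊆ H`
    have hth : t - h ∈ H := hbottom H hH ⟨h₀, hh₀, fun h0 ↦ hne (by rw [h0, smul_zero])⟩ _
      (by rw [smul_sub, ← hht, sub_self])
    have := H.add_mem hth hh
    rwa [sub_add_cancel] at this

end Devissage

end Summit.BirchSwinnertonDyer.BirchSwinnertonDyer.Theorems.KolyvaginLowerBoundAtTwo

end
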